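import Literature.MathematicalPhysics.QuantumManyBody.PositiveTypePointCharges
import HarnessLib

/-!
# Functions of positive type from a nonnegative Fourier transform

Topic `Literature/MathematicalPhysics/QuantumManyBody` (electrostatics groundwork for the charged
Bose gas, `JelliumBoseGas.foldyLaw`). `Coulomb.positiveType_points_ge` (the mechanism of the
sliding lemma [ConlonLiebYau1988, Lemma 2.1; LiebSolovej2001, Lemma 3.1]) is stated for kernels
presented as `F(z) = ∫ Φ(p) cos(2π⟨p, z⟩) dp` with `Φ ≥ 0` integrable. This file supplies the
bridge from Mathlib's Fourier transform: if `f : ℝ³ → ℝ` is continuous, integrable and even, and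
`𝓕f` (Mathlib's `𝓕`, applied to `f` viewed as complex valued) is integrable, then `𝓕f` is real and,
by Fourier inversion [Mathlib `Continuous.fourierInv_fourier_eq`],

**`f(z) = ∫ Re 𝓕f(p) · cos(2π⟨p, z⟩) dp`** for every `z`, in particular `f(0) = ∫ Re 𝓕f`;

hence, when `Re 𝓕f ≥ 0` ("`f` has a non-negative Fourier transform", the conclusion of
[ConlonLiebYau1988, Lemma 2.1]), `f` satisfies the point-charge inequality
`∑_{i<j} cᵢcⱼ f(xᵢ - xⱼ) - ∑ᵢ cᵢ ∫ g f(xᵢ - ·) + ½∬ g g f ≥ -½ f(0) ∑ cᵢ²`.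

* `Coulomb.fourier_ofReal_even_im_eq_zero` — `Im 𝓕f = 0` for even real `f`.
* `Coulomb.eq_integral_re_fourier_mul_cos_of_continuousAt`, `eq_integral_re_fourier_mul_cos` —
  **the representation** `f(z) = ∫ Re𝓕f(p)cos(2π⟨p,z⟩)dp` (at points of continuity / everywhere).
* `Coulomb.positiveType_points_ge_of_fourier_nonneg` — the point-charge inequality for such `f`.

## References

* [ConlonLiebYau1988] J. G. Conlon, E. H. Lieb, H.-T. Yau, Commun. Math. Phys. 116 (1988) 417–448,
  Lemma 2.1.
* [LiebSolovej2001] E. H. Lieb, J. P. Solovej, Commun. Math. Phys. 217 (2001) 127–163, Lemma 3.1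
  (proof).
* [LiebLoss2001] E. H. Lieb, M. Loss, *Analysis*, 2nd ed. (2001), Thm. 5.5 (Fourier inversion) and
  §5.10 (positive definiteness).
-/

noncomputable section

open MeasureTheory Set Filter Real
open scoped ENNReal NNReal Topology FourierTransform InnerProductSpace

namespace Literature.MathematicalPhysics.QuantumManyBody.Coulomb

open BoseGas

/-- Real part of `e^{iθ} w`: `Re(e^{iθ}w) = cos θ · Re w - sin θ · Im w`. [folklore] -/
theorem re_cexp_mul_I_mul (θ : ℝ) (w : ℂ) :
    (Complex.exp ((θ : ℂ) * Complex.I) * w).re = Real.cos θ * w.re - Real.sin θ * w.im := by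
  rw [Complex.exp_mul_I]
  simp [Complex.mul_re, Complex.add_re, Complex.add_im, Complex.mul_im, Complex.cos_ofReal_re,
    Complex.sin_ofReal_re, Complex.cos_ofReal_im, Complex.sin_ofReal_im]

/-- Imaginary part of `e^{iθ} (a : ℝ)`: `Im(e^{iθ}a) = sin θ · a`. [folklore] -/
theorem im_cexp_mul_I_mul_ofReal (θ a : ℝ) :
    (Complex.exp ((θ : ℂ) * Complex.I) * (a : ℂ)).im = Real.sin θ * a := by
  rw [Complex.exp_mul_I]
  simp [Complex.mul_re, Complex.add_re, Complex.add_im, Complex.mul_im, Complex.cos_ofReal_re,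
    Complex.sin_ofReal_re, Complex.cos_ofReal_im, Complex.sin_ofReal_im]

/-- **The Fourier transform of an even real function is real**: for `f : ℝ³ → ℝ` integrable with
`f(-x) = f(x)`, `Im 𝓕f(p) = -∫ sin(2π⟨x, p⟩) f(x) dx = 0` (the integrand is odd). [folklore] -/
theorem fourier_ofReal_even_im_eq_zero {f : Space → ℝ} (hfi : Integrable f) (heven : ∀ x, f (-x) = f x)
    (p : Space) : (𝓕 (fun x : Space => (f x : ℂ)) p).im = 0 := by
  rw [Real.fourier_eq']
  simp only [smul_eq_mul]
  have hfiC : Integrable fun x : Space => (f x : ℂ) := hfi.ofReal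
  have hint : Integrable fun v : Space => Complex.exp (((-2 * π * ⟪v, p⟫_ℝ : ℝ) : ℂ) * Complex.I) * (f v : ℂ) := by
    refine hfiC.norm.mono' ?_ (Eventually.of_forall fun v => ?_)
    · exact ((Complex.continuous_exp.comp ((Complex.continuous_ofReal.comp
        ((continuous_const.mul (continuous_inner.comp (continuous_id.prodMk continuous_const))))).mul
          continuous_const)).aestronglyMeasurable).mul hfiC.aestronglyMeasurable
    · rw [norm_mul, Complex.norm_exp_ofReal_mul_I, one_mul]
  rw [← RCLike.im_to_complex, ← integral_im hint]
  simp only [RCLike.im_to_complex, im_cexp_mul_I_mul_ofReal]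
  -- the integrand `v ↦ sin(-2π⟨v,p⟩) f(v)` is odd
  have hodd : ∫ v : Space, Real.sin (-2 * π * ⟪v, p⟫_ℝ) * f v =
      -∫ v : Space, Real.sin (-2 * π * ⟪v, p⟫_ℝ) * f v := by
    conv_lhs => rw [← integral_neg_eq_self]
    rw [← integral_neg]
    refine integral_congr_ae (Eventually.of_forall fun v => ?_)
    simp only [inner_neg_left, heven]
    rw [show -2 * π * -⟪v, p⟫_ℝ = -(-2 * π * ⟪v, p⟫_ℝ) by ring, Real.sin_neg]
    ring
  linarith

/-- **Representation of an even function by its (real, integrable) Fourier transform, at a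
point of continuity**: for `f : ℝ³ → ℝ` integrable and even with `𝓕f` integrable, and `z` a point
of continuity of `f`, `f(z) = ∫ Re 𝓕f(p) cos(2π⟨p, z⟩) dp` (Fourier inversion at `z`; the `sin`
part drops because `𝓕f` is real). [cite: LiebLoss2001, Thm. 5.5] -/
theorem eq_integral_re_fourier_mul_cos_of_continuousAt {f : Space → ℝ} (hfi : Integrable f)
    (hF : Integrable (𝓕 (fun x : Space => (f x : ℂ)))) (heven : ∀ x, f (-x) = f x) {z : Space}
    (hz : ContinuousAt f z) :
    f z = ∫ p, (𝓕 (fun x : Space => (f x : ℂ)) p).re * Real.cos (2 * π * ⟪p, z⟫_ℝ) := by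
  have hfiC : Integrable fun x : Space => (f x : ℂ) := hfi.ofReal
  have hcont : ContinuousAt (fun x : Space => (f x : ℂ)) z :=
    Complex.continuous_ofReal.continuousAt.comp hz
  have hinv := hfiC.fourierInv_fourier_eq hF hcont
  have hz' : (f z : ℂ) = 𝓕⁻ (𝓕 (fun x : Space => (f x : ℂ))) z := by
    rw [hinv]
  rw [Real.fourierInv_eq'] at hz'
  simp only [smul_eq_mul] at hz'
  have hint : Integrable fun v : Space =>
      Complex.exp (((2 * π * ⟪v, z⟫_ℝ : ℝ) : ℂ) * Complex.I) * 𝓕 (fun x : Space => (f x : ℂ)) v := by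
    refine hF.norm.mono' ?_ (Eventually.of_forall fun v => ?_)
    · exact ((Complex.continuous_exp.comp ((Complex.continuous_ofReal.comp
        ((continuous_const.mul (continuous_inner.comp (continuous_id.prodMk continuous_const))))).mul
          continuous_const)).aestronglyMeasurable).mul hF.aestronglyMeasurable
    · rw [norm_mul, Complex.norm_exp_ofReal_mul_I, one_mul]
  have hre : f z = (∫ v : Space,
      Complex.exp (((2 * π * ⟪v, z⟫_ℝ : ℝ) : ℂ) * Complex.I) * 𝓕 (fun x : Space => (f x : ℂ)) v).re := by
    rw [← hz', Complex.ofReal_re]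
  rw [hre, ← RCLike.re_to_complex, ← integral_re hint]
  refine integral_congr_ae (Eventually.of_forall fun v => ?_)
  simp only [RCLike.re_to_complex, re_cexp_mul_I_mul, fourier_ofReal_even_im_eq_zero hfi heven v,
    mul_zero, sub_zero]
  rw [real_inner_comm]
  ring

/-- **Representation of an even function by its (real, integrable) Fourier transform**: for
`f : ℝ³ → ℝ` continuous, integrable and even with `𝓕f` integrable,
`f(z) = ∫ Re 𝓕f(p) cos(2π⟨p, z⟩) dp` for every `z`. [cite: LiebLoss2001, Thm. 5.5] -/
theorem eq_integral_re_fourier_mul_cos {f : Space → ℝ} (hfc : Continuous f) (hfi : Integrable f)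
    (hF : Integrable (𝓕 (fun x : Space => (f x : ℂ)))) (heven : ∀ x, f (-x) = f x) (z : Space) :
    f z = ∫ p, (𝓕 (fun x : Space => (f x : ℂ)) p).re * Real.cos (2 * π * ⟪p, z⟫_ℝ) :=
  eq_integral_re_fourier_mul_cos_of_continuousAt hfi hF heven hfc.continuousAt

/-- `f(0) = ∫ Re 𝓕f` for `f` as in `eq_integral_re_fourier_mul_cos`. [cite: LiebLoss2001, Thm. 5.5] -/
theorem apply_zero_eq_integral_re_fourier {f : Space → ℝ} (hfc : Continuous f) (hfi : Integrable f)
    (hF : Integrable (𝓕 (fun x : Space => (f x : ℂ)))) (heven : ∀ x, f (-x) = f x) :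
    f 0 = ∫ p, (𝓕 (fun x : Space => (f x : ℂ)) p).re := by
  rw [eq_integral_re_fourier_mul_cos hfc hfi hF heven 0]
  simp

/-- **Point charges and background in a kernel with non-negative Fourier transform**
[LiebSolovej2001, Lemma 3.1 (proof); ConlonLiebYau1988, Lemma 2.1]: let `f : ℝ³ → ℝ` be
continuous, integrable and even, with `𝓕f` integrable and `Re 𝓕f ≥ 0`. Then for real charges
`cᵢ` at points `xᵢ` and a measurable integrable background `g`,
`∑_{i<j} cᵢcⱼ f(xᵢ - xⱼ) - ∑ᵢ cᵢ ∫ g(y) f(xᵢ - y) dy + ½ ∬ g(x)g(y) f(x - y) ≥ -½ f(0) ∑ᵢ cᵢ²`.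
[cite: LiebSolovej2001, Lemma 3.1 (proof)] -/
theorem positiveType_points_ge_of_fourier_nonneg {f : Space → ℝ} (hfc : Continuous f)
    (hfi : Integrable f) (hF : Integrable (𝓕 (fun x : Space => (f x : ℂ))))
    (heven : ∀ x, f (-x) = f x) (hpos : ∀ p, 0 ≤ (𝓕 (fun x : Space => (f x : ℂ)) p).re)
    {N : ℕ} (c : Fin N → ℝ) (X : Fin N → Space) {g : Space → ℝ} (hgm : Measurable g)
    (hg : Integrable g) :
    -(1 / 2 * f 0 * ∑ i, c i ^ 2) ≤
      (∑ i, ∑ j with i < j, c i * c j * f (X i - X j)) -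
        (∑ i, c i * ∫ y, g y * f (X i - y)) +
        1 / 2 * ∫ z : Space × Space, g z.1 * g z.2 * f (z.1 - z.2) ∂(volume.prod volume) := by
  have hfiC : Integrable fun x : Space => (f x : ℂ) := hfi.ofReal
  have hΦc : Continuous fun p : Space => (𝓕 (fun x : Space => (f x : ℂ)) p).re :=
    Complex.continuous_re.comp (VectorFourier.fourierIntegral_continuous Real.continuous_fourierChar
      (innerSL ℝ).continuous₂ hfiC)
  have h := positiveType_points_ge hΦc.measurable hF.re hpos c X hgm hg
  have hrep : ∀ w : Space, ∫ p, (𝓕 (fun x : Space => (f x : ℂ)) p).re * Real.cos (2 * π * ⟪p, w⟫_ℝ) =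
      f w := fun w => (eq_integral_re_fourier_mul_cos hfc hfi hF heven w).symm
  simp only [hrep] at h
  rw [← apply_zero_eq_integral_re_fourier hfc hfi hF heven] at h
  exact h

end Literature.MathematicalPhysics.QuantumManyBody.Coulomb
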